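/-
Origin: expansion seat `planner-pub-hodgecm-toy2-g7-0`, handover #2 HANDOVER 2026-08-18T13:17:53Z (l.3882) md5 5fc0db2b; tree-only imports (packager row: handed in STATUS without a t30 kit row; RUN 30 addendum) (`HOME/pub-hodgecm-toy2-g7/lean/Toy2g7/PullbackMod.lean`, md5 5fc0db2b, 315 lines);
landed by the gen-8 packager in gate run 30 as `HodgeCM/Model/Toy/PullbackMod.lean` (verbatim).
-/
/-
Origin: CONSISTENCY seat 2 gen 7 `planner-pub-hodgecm-toy2-g7-0` (unit `pub-hodgecm-toy2-g7`), WIP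
`HOME/pub-hodgecm-toy2-g7/lean/Toy2g7/PullbackMod.lean`; intended target `HodgeCM/Model/Toy/PullbackMod.lean` (new leaf).
-/
import Mathlib
import Summits.HodgeConjecture.HodgeCM.Model.Toy.BalMod
import Summits.HodgeConjecture.HodgeCM.Model.TruncAlg
import Summits.HodgeConjecture.HodgeCM.Proofs.Pohlmann.NonGaloisIndex
import Summits.HodgeConjecture.HodgeCM.StubTree.Qw8
import Summits.HodgeConjecture.HodgeCM.StubTree.Inputs

/-!
# The pullback-family modifier `U.pbMod`: a universe-generic candidate witness for the F4 binder

Load-bearing census of `HodgeCM.Assembly.COR_CM_of_descentFactsB₄`, binder `h4 : U.Fact_cupAlg` (F4).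

For ANY universe `U` put `B^p(X) := ⊤` if `p ≤ 2` or `dim X ≤ p + 2` ("full regime"), and otherwise
`B^p(X) := ⨆_{Y, dim Y ≤ p+2} ⨆_{f : X → Y} range (f^* : H^{2p}(Y) → H^{2p}(X))` — the classes pulled back from
varieties of dimension `≤ p + 2`.  The modifier `U.pbMod := U.balMod B (fun _ => False)` replaces `Alg^p(X)` by
`Alg^p(X) ⊓ B^p(X)` (generic machinery of `HodgeCM.Model.Toy.BalMod`).  It is the SMALLEST pull-back-closed shrinking of
`Alg` that keeps codimension `≤ 2` and the near-top codimensions `≥ dim X - 2` — exactly the codimensions the model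
axioms constrain (M9 `cup_alg`, M10 Lefschetz (1,1), M26 `gysin_surface`, M28 `algDuality`).

* `ModelAxioms.pbMod` — **`U.pbMod` satisfies all 28 model axioms whenever `U` does** (no further hypothesis).
* the alg-free facts transfer verbatim: N1–N4, F5, `Fact_dimProd` (D), F-H0 (M43) and BOTH realisations.
* `not_hc_cm_pbMod` — `HC_CM` FAILS in `U.pbMod` as soon as `U` has a CM variety `X` and a codimension `p` outside the
  full regime (`2 < p`, `p + 2 < dim X`) with a nonzero Hodge class and `U.Inert X p`: every pull-back
  `f^* : H^{2p}(Y) → H^{2p}(X)` from a variety of dimension `≤ p + 2` vanishes;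
  `not_fact_cupAlg_pbMod` — under the same inertness F4 FAILS explicitly (a nonzero cup of two low-codimension classes).
* `hodgeClassesOf_three_ne_bot` — the needed nonzero Hodge class: `B³(A_{(F,Φ)}) ≠ 0` for `F` Galois CM of degree
  `≥ 6` (three conjugate pairs form a Hodge weight; Pohlmann basis `pohlmannBasis_of_facts`), from `ModelAxioms` + N1–N4.

What is NOT proved here (and is the remaining input of the F4 row, see `TOY2-G7.md`): an inert CM variety in a
concrete model (`Toy2g7.SimpleAtom`: inertness of `A_{(K,Φ)}` in `toyUniverse₃` reduces to the simplicity of the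
rational Hodge structure `H¹(A_{(K,Φ)})`, i.e. primitivity of `Φ`), and the status of F7d-B in `U.pbMod` (open).
All proofs kernel-checked; nothing is cited.
-/

noncomputable section

open scoped TensorProduct
open NumberField NumberField.ComplexEmbedding NumberField.InfinitePlace

attribute [local instance] Classical.propDecidable

namespace HodgeCM

open Literature.AlgebraicGeometry.Motives (CMType)
open CMTypeOps NonGalois

namespace Universe

variable (U : Universe)

/-! ### The pullback family and the modifier -/

open Classical in
/-- `B^p(X)`: everything in the full regime `p ≤ 2 ∨ dim X ≤ p + 2`, else the span of the pull-backs from varieties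
of dimension `≤ p + 2`. -/
def pbFam (X : U.Var) (p : ℕ) : Submodule ℚ (U.Coh X (2 * p)) :=
  if p ≤ 2 ∨ U.dim X ≤ p + 2 then ⊤
  else ⨆ (Y : U.Var), ⨆ (_ : U.dim Y ≤ p + 2), ⨆ (f : U.Mor X Y), LinearMap.range (U.pull f (2 * p))

/-- **The pullback-family modifier** `U♭ := U.balMod B (fun _ => False)`. -/
@[reducible] def pbMod : Universe := U.balMod U.pbFam (fun _ => False)

variable {U}

/-- (Ported verbatim from the HodgeCMPerL package; no docstring in the source.) -/
theorem pbFam_of_full {X : U.Var} {p : ℕ} (h : p ≤ 2 ∨ U.dim X ≤ p + 2) : U.pbFam X p = ⊤ := by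
  rw [pbFam, if_pos h]

/-- (Ported verbatim from the HodgeCMPerL package; no docstring in the source.) -/
theorem pbFam_of_not_full {X : U.Var} {p : ℕ} (h : ¬ (p ≤ 2 ∨ U.dim X ≤ p + 2)) :
    U.pbFam X p = ⨆ (Y : U.Var), ⨆ (_ : U.dim Y ≤ p + 2), ⨆ (f : U.Mor X Y), LinearMap.range (U.pull f (2 * p)) := by
  rw [pbFam, if_neg h]

/-- (Ported verbatim from the HodgeCMPerL package; no docstring in the source.) -/
theorem pbMod_alg (X : U.Var) (p : ℕ) : U.pbMod.alg X p = U.alg X p ⊓ U.pbFam X p := rfl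

/-- (Ported verbatim from the HodgeCMPerL package; no docstring in the source.) -/
theorem mem_pbMod_alg {X : U.Var} {p : ℕ} (x : U.Coh X (2 * p)) :
    x ∈ U.pbMod.alg X p ↔ x ∈ U.alg X p ∧ x ∈ U.pbFam X p := Submodule.mem_inf

/-- (Ported verbatim from the HodgeCMPerL package; no docstring in the source.) -/
theorem pbMod_alg_of_full {X : U.Var} {p : ℕ} (h : p ≤ 2 ∨ U.dim X ≤ p + 2) : U.pbMod.alg X p = U.alg X p := by
  rw [pbMod_alg, pbFam_of_full h, inf_top_eq]

/-- **`B` is closed under pull-back** (M2 `Fact_pull_comp` composes the pull-backs in the non-full regime). -/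
theorem pbFam_pull (h2 : U.Fact_pull_comp) (X Y : U.Var) (f : U.Mor X Y) (p : ℕ) :
    (U.pbFam Y p).map (U.pull f (2 * p)) ≤ U.pbFam X p := by
  by_cases hX : p ≤ 2 ∨ U.dim X ≤ p + 2
  · rw [pbFam_of_full hX]
    exact le_top
  by_cases hY : p ≤ 2 ∨ U.dim Y ≤ p + 2
  · have hYd : U.dim Y ≤ p + 2 := hY.resolve_left fun hp => hX (Or.inl hp)
    rw [pbFam_of_full hY, pbFam_of_not_full hX, Submodule.map_top]
    exact le_iSup_of_le Y (le_iSup_of_le hYd (le_iSup_of_le f le_rfl))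
  · rw [pbFam_of_not_full hY, pbFam_of_not_full hX, Submodule.map_iSup]
    refine iSup_le fun Z => ?_
    rw [Submodule.map_iSup]
    refine iSup_le fun hZ => ?_
    rw [Submodule.map_iSup]
    refine iSup_le fun g => ?_
    rw [← LinearMap.range_comp, ← h2 X Y Z f g (2 * p)]
    exact le_iSup_of_le Z (le_iSup_of_le hZ (le_iSup_of_le (U.comp f g) le_rfl))

/-! ### The 28 model axioms -/

/-- M26 for `U♭`: the Gysin class lives in the near-top codimension `dim X - 2`, where `B = ⊤`. -/
theorem pbMod_fact_gysin_surface (M : U.ModelAxioms) : U.pbMod.Fact_gysin_surface := by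
  intro S X f hS
  obtain ⟨c, hc, h⟩ := M.gysin_surface S X f hS
  refine ⟨c, ?_, h⟩
  show c ∈ U.alg X (U.dim X - 2) ⊓ U.pbFam X (U.dim X - 2)
  rw [pbFam_of_full (Or.inr (by omega))]
  exact Submodule.mem_inf.mpr ⟨hc, Submodule.mem_top⟩

/-- M28 for `U♭`: both codimensions `dim P - 2` and `2` of the duality map are in the full regime. -/
theorem pbMod_fact_algDuality (M : U.ModelAxioms) : U.pbMod.Fact_algDuality := by
  intro K Φ
  obtain ⟨D, hD, hmap, hdiag⟩ := M.algDuality K Φ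
  refine ⟨D, hD, ?_, hdiag⟩
  show (U.alg _ (U.dim (U.prod4 K Φ) - 2) ⊓ U.pbFam _ (U.dim (U.prod4 K Φ) - 2)).map D ≤
    U.alg (U.prod4 K Φ) 2 ⊓ U.pbFam (U.prod4 K Φ) 2
  rw [pbFam_of_full (p := 2) (Or.inl le_rfl)]
  exact le_inf ((Submodule.map_mono inf_le_left).trans hmap) le_top

/-- **`ModelAxioms U♭` from `ModelAxioms U`**, unconditionally. -/
theorem ModelAxioms.pbMod (M : U.ModelAxioms) : U.pbMod.ModelAxioms :=
  ModelAxioms.balMod M (pbFam_pull M.pull_comp)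
    (fun X x y _ _ => by
      rw [pbFam_of_full (p := 2) (Or.inl le_rfl)]
      exact Submodule.mem_top)
    (fun X => by
      rw [pbFam_of_full (p := 1) (Or.inl (by norm_num))]
      exact le_top)
    (balMod_fact_cmDominated M.cmDominated fun _ h => h.elim)
    (pbMod_fact_gysin_surface M) (pbMod_fact_algDuality M)

/-! ### The alg-free facts transfer verbatim -/

set_option smartUnfolding false in
/-- (Ported verbatim from the HodgeCMPerL package; no docstring in the source.) -/
theorem pbMod_fact_cupExterior_iff : U.pbMod.Fact_cupExterior ↔ U.Fact_cupExterior := Iff.rfl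
/-- (Ported verbatim from the HodgeCMPerL package; no docstring in the source.) -/
theorem pbMod_fact_cup_hodge_iff : U.pbMod.Fact_cup_hodge ↔ U.Fact_cup_hodge := Iff.rfl
/-- (Ported verbatim from the HodgeCMPerL package; no docstring in the source.) -/
theorem pbMod_fact_pull_H0_iff : U.pbMod.Fact_pull_H0 ↔ U.Fact_pull_H0 := Iff.rfl
/-- (Ported verbatim from the HodgeCMPerL package; no docstring in the source.) -/
theorem pbMod_fact_hodge_F0_iff : U.pbMod.Fact_hodge_F0 ↔ U.Fact_hodge_F0 := Iff.rfl
/-- (Ported verbatim from the HodgeCMPerL package; no docstring in the source.) -/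
theorem pbMod_fact_cupAssoc_iff : U.pbMod.Fact_cupAssoc ↔ U.Fact_cupAssoc := Iff.rfl
/-- (Ported verbatim from the HodgeCMPerL package; no docstring in the source.) -/
theorem pbMod_fact_dimProd_iff : U.pbMod.Fact_dimProd ↔ U.Fact_dimProd := Iff.rfl
set_option smartUnfolding false in
/-- (Ported verbatim from the HodgeCMPerL package; no docstring in the source.) -/
theorem pbMod_fact_unitH0_iff : U.pbMod.Fact_unitH0 ↔ U.Fact_unitH0 := Iff.rfl

/-- `RealisationExistsFace` transfers verbatim (its data never mention `Alg` or the CM predicate). -/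
theorem pbMod_realisationExistsFace (h : U.RealisationExistsFace) : U.pbMod.RealisationExistsFace := by
  intro F hG h6 f ι₁ hf V
  obtain ⟨r⟩ := h F hG h6 f ι₁ hf V
  exact ⟨{ r with }⟩

/-- `RealisationExistsPerL` transfers verbatim. -/
theorem pbMod_realisationExistsPerL (h : U.RealisationExistsPerL) : U.pbMod.RealisationExistsPerL := by
  intro K L j hN hK hL φ hφ ι₁ hι t ht V
  obtain ⟨r⟩ := h K L j hN hK hL φ hφ ι₁ hι t ht V
  exact ⟨{ r with }⟩

/-! ### Inert varieties: `HC_CM` and F4 fail in `U♭` -/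

variable (U) in
/-- `X` is **inert in codimension `p`**: every pull-back `f^* : H^{2p}(Y) → H^{2p}(X)` from a variety `Y` of dimension
`≤ p + 2` vanishes.  (In `toyUniverse₃`: `X = A_{(K,Φ)}` with `H¹` a simple rational Hodge structure of rank `> 2p + 5`,
see `Toy2g7.SimpleAtom`.) -/
def Inert (X : U.Var) (p : ℕ) : Prop := ∀ Y : U.Var, U.dim Y ≤ p + 2 → ∀ f : U.Mor X Y, U.pull f (2 * p) = 0

/-- (Ported verbatim from the HodgeCMPerL package; no docstring in the source.) -/
theorem pbFam_eq_bot_of_inert {X : U.Var} {p : ℕ} (hX : ¬ (p ≤ 2 ∨ U.dim X ≤ p + 2)) (hI : U.Inert X p) :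
    U.pbFam X p = ⊥ := by
  rw [pbFam_of_not_full hX]
  refine iSup_eq_bot.mpr fun Y => iSup_eq_bot.mpr fun hY => iSup_eq_bot.mpr fun f => ?_
  rw [hI Y hY f, LinearMap.range_zero]

/-- (Ported verbatim from the HodgeCMPerL package; no docstring in the source.) -/
theorem pbMod_hc_cm_iff :
    U.pbMod.HC_CM ↔ ∀ X : U.Var, (U.IsCMAbelianVariety X ∨ False) → ∀ p : ℕ,
      U.hodgeClassesOf X p ≤ U.alg X p ⊓ U.pbFam X p :=
  Iff.rfl

/-- **`HC_CM` fails in `U♭`** at an inert CM variety with a nonzero Hodge class outside the full regime. -/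
theorem not_hc_cm_pbMod {X : U.Var} {p : ℕ} (hCM : U.IsCMAbelianVariety X) (hp : 2 < p) (hd : p + 2 < U.dim X)
    (hI : U.Inert X p) (hne : U.hodgeClassesOf X p ≠ ⊥) : ¬ U.pbMod.HC_CM := by
  intro h
  have hle := (pbMod_hc_cm_iff.mp h) X (Or.inl hCM) p
  rw [pbFam_eq_bot_of_inert (by omega) hI, inf_bot_eq] at hle
  exact hne (le_bot_iff.mp hle)

/-- **F4 fails in `U♭`** at an inert variety: two algebraic classes of codimension `≤ 2` whose cup (of codimension
`p + q` outside the full regime) is nonzero. -/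
theorem not_fact_cupAlg_pbMod {X : U.Var} {p q : ℕ} (x : U.Coh X (2 * p)) (y : U.Coh X (2 * q))
    (hx : x ∈ U.alg X p) (hy : y ∈ U.alg X q) (hp : p ≤ 2) (hq : q ≤ 2) (hpq : 2 < p + q) (hd : p + q + 2 < U.dim X)
    (hI : U.Inert X (p + q)) (hxy : U.castCoh X (l := 2 * (p + q)) (by omega) (U.cup X (2 * p) (2 * q) x y) ≠ 0) :
    ¬ U.pbMod.Fact_cupAlg := by
  intro h
  have hx' : x ∈ U.pbMod.alg X p := by
    rw [pbMod_alg_of_full (Or.inl hp)]; exact hx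
  have hy' : y ∈ U.pbMod.alg X q := by
    rw [pbMod_alg_of_full (Or.inl hq)]; exact hy
  have hmem := (mem_pbMod_alg _).mp (h X p q x y hx' hy')
  rw [pbFam_eq_bot_of_inert (by omega) hI, Submodule.mem_bot] at hmem
  exact hxy hmem.2

/-! ### A nonzero Hodge class of codimension 3 on a single CM factor -/

section ThreePairs

variable {F : CMField}

/-- the infinite places of a CM field: `2 · #places = [F:ℚ]` -/
theorem two_mul_card_infinitePlace (F : CMField) : 2 * Fintype.card (InfinitePlace F) = Module.finrank ℚ F := by
  have h1 := card_add_two_mul_card_eq_rank (K := F)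
  have h2 := card_eq_nrRealPlaces_add_nrComplexPlaces (K := F)
  have h0 : nrRealPlaces F = 0 := (nrRealPlaces_eq_zero_iff (K := F)).mpr inferInstance
  omega

/-- embeddings over distinct places are distinct -/
theorem embedding_ne_of_mk_ne {s t : (F : Type) →+* ℂ} (h : InfinitePlace.mk s ≠ InfinitePlace.mk t) : s ≠ t :=
  fun hst => h (by rw [hst])

/-- the weight made of the conjugate pairs over three places -/
def threePairs (w : Fin 3 → InfinitePlace F) : Finset ((F : Type) →+* ℂ) :=
  Finset.univ.biUnion fun i => ({(w i).embedding, conjugate (w i).embedding} : Finset ((F : Type) →+* ℂ))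

/-- (Ported verbatim from the HodgeCMPerL package; no docstring in the source.) -/
theorem mk_eq_of_mem_pair {w : InfinitePlace F} {x : (F : Type) →+* ℂ}
    (hx : x ∈ ({w.embedding, conjugate w.embedding} : Finset ((F : Type) →+* ℂ))) : InfinitePlace.mk x = w := by
  rcases Finset.mem_insert.mp hx with rfl | hx
  · exact mk_embedding w
  · rw [Finset.mem_singleton.mp hx, mk_conjugate_eq, mk_embedding]

/-- (Ported verbatim from the HodgeCMPerL package; no docstring in the source.) -/
theorem pairwiseDisjoint_pairs {w : Fin 3 → InfinitePlace F} (hw : Function.Injective w) :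
    ((Finset.univ : Finset (Fin 3)) : Set (Fin 3)).PairwiseDisjoint
      fun i => ({(w i).embedding, conjugate (w i).embedding} : Finset ((F : Type) →+* ℂ)) := by
  intro i _ j _ hij
  refine Finset.disjoint_left.mpr fun x hxi hxj => hij (hw ?_)
  rw [← mk_eq_of_mem_pair hxi, ← mk_eq_of_mem_pair hxj]

/-- (Ported verbatim from the HodgeCMPerL package; no docstring in the source.) -/
theorem card_threePairs {w : Fin 3 → InfinitePlace F} (hw : Function.Injective w) : (threePairs w).card = 6 := by
  rw [threePairs, Finset.card_biUnion (pairwiseDisjoint_pairs hw)]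
  simp_rw [card_pair_conjugate]
  simp

/-- (Ported verbatim from the HodgeCMPerL package; no docstring in the source.) -/
theorem sum_threePairs {w : Fin 3 → InfinitePlace F} (hw : Function.Injective w) (g : ((F : Type) →+* ℂ) → ℤ) :
    ∑ x ∈ threePairs w, g x = ∑ i : Fin 3, (g (w i).embedding + g (conjugate (w i).embedding)) := by
  rw [threePairs, Finset.sum_biUnion (pairwiseDisjoint_pairs hw)]
  refine Finset.sum_congr rfl fun i _ => ?_
  rw [Finset.sum_pair (conjugate_ne_self _).symm]

/-- **three conjugate pairs form a Hodge weight of degree 3** on the single factor `A_{(F,Θ)}`, for every type `Θ` -/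
theorem isHodgeWeight_threePairs (Θ : CMType F) {w : Fin 3 → InfinitePlace F} (hw : Function.Injective w) :
    IsHodgeWeight (fun _ : Fin (0 + 1) => Θ) 3 (fun _ => threePairs w) := by
  refine ⟨?_, fun P => ?_⟩
  · rw [sum_univ_fin_one]
    exact card_threePairs hw
  · rw [sum_univ_fin_one]
    show ∑ x ∈ threePairs w, ind Θ (P.1 x) = 3
    rw [sum_threePairs hw]
    simp_rw [GalT.apply_conjugate, ind_add_ind_conjugate]
    simp

/-- three distinct places exist once `[F:ℚ] ≥ 6` -/
theorem exists_three_places (h6 : 6 ≤ Module.finrank ℚ F) : ∃ w : Fin 3 → InfinitePlace F, Function.Injective w := by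
  have hc : Fintype.card (Fin 3) ≤ Fintype.card (InfinitePlace F) := by
    have := two_mul_card_infinitePlace F
    rw [Fintype.card_fin]
    omega
  obtain ⟨e⟩ := Function.Embedding.nonempty_of_card_le hc
  exact ⟨e, e.injective⟩

/-- **`B³(A_{(F,Φ)}) ≠ 0`** for `F` Galois CM of degree `≥ 6` (`ModelAxioms` + N1–N4, via the Pohlmann basis). -/
theorem hodgeClassesOf_three_ne_bot (M : U.ModelAxioms) (hN1 : U.Fact_cupExterior) (hN2 : U.Fact_cup_hodge)
    (hN3 : U.Fact_pull_H0) (hN4 : U.Fact_hodge_F0) [IsGalois ℚ F] (h6 : 6 ≤ Module.finrank ℚ F) (Φ : CMType F) :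
    U.hodgeClassesOf (U.cmProd F (fun _ : Fin (0 + 1) => Φ)) 3 ≠ ⊥ := by
  intro hbot
  obtain ⟨w, hw⟩ := exists_three_places (F := F) h6
  have hS := isHodgeWeight_threePairs Φ hw
  have h1 : Module.finrank ℂ (U.weightSpace F (fun _ : Fin (0 + 1) => Φ) (fun _ => threePairs w) (2 * 3)) = 1 :=
    finrank_weightSpace_of_isHodgeWeight M hN1 (by norm_num) hS
  have hne : U.weightSpace F (fun _ : Fin (0 + 1) => Φ) (fun _ => threePairs w) (2 * 3) ≠ ⊥ := by
    intro h
    rw [h, finrank_bot] at h1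
    exact zero_ne_one h1
  obtain ⟨x, hx, hx0⟩ := Submodule.exists_mem_ne_zero_of_ne_bot hne
  have hB := pohlmannBasis_of_facts M hN1 hN2 hN3 hN4 F ‹_› 0 (fun _ : Fin (0 + 1) => Φ) 3
  rw [hbot, Submodule.baseChange_bot] at hB
  have hx' : x ∈ (⊥ : Submodule ℂ _) := by
    rw [hB]
    exact Submodule.mem_iSup_of_mem _ (Submodule.mem_iSup_of_mem hS hx)
  exact hx0 ((Submodule.mem_bot ℂ).mp hx')

end ThreePairs

/-! ### Packaging: the profile of `U♭` -/

set_option smartUnfolding false in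
/-- **The profile of `U♭`**: from `ModelAxioms`, the face realisation and N1–N4, F5, D, F-H0 for `U`, the same list for
`U♭`; and `¬ HC_CM(U♭)` from one inert CM variety `A_{(F,Φ)}` (`F` Galois, `[F:ℚ] ≥ 12`) in codimension `3`. -/
theorem pbMod_profile (M : U.ModelAxioms) (hR : U.RealisationExistsFace) (hN1 : U.Fact_cupExterior)
    (hN2 : U.Fact_cup_hodge) (hN3 : U.Fact_pull_H0) (hN4 : U.Fact_hodge_F0) (h5 : U.Fact_cupAssoc)
    (hd : U.Fact_dimProd) (hu : U.Fact_unitH0) {F : CMField} [IsGalois ℚ F] (h12 : 12 ≤ Module.finrank ℚ F)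
    (Φ : CMType F) (hI : U.Inert (U.cmProd F (fun _ : Fin (0 + 1) => Φ)) 3) :
    U.pbMod.ModelAxioms ∧ U.pbMod.RealisationExistsFace ∧ U.pbMod.Fact_cupExterior ∧ U.pbMod.Fact_cup_hodge ∧
      U.pbMod.Fact_pull_H0 ∧ U.pbMod.Fact_hodge_F0 ∧ U.pbMod.Fact_cupAssoc ∧ U.pbMod.Fact_dimProd ∧
      U.pbMod.Fact_unitH0 ∧ ¬ U.pbMod.HC_CM := by
  refine ⟨M.pbMod, pbMod_realisationExistsFace hR, pbMod_fact_cupExterior_iff.mpr hN1, hN2, hN3, hN4, h5, hd,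
    pbMod_fact_unitH0_iff.mpr hu, ?_⟩
  have hX : U.IsCMAbelianVariety (U.cmProd F (fun _ : Fin (0 + 1) => Φ)) := (M.cmAV F Φ).2.1
  have hdim : U.dim (U.cmProd F (fun _ : Fin (0 + 1) => Φ)) = (0 + 1) * F.halfDegree := dim_cmProd M hd F _
  have hdim' : 3 + 2 < U.dim (U.cmProd F (fun _ : Fin (0 + 1) => Φ)) := by
    rw [hdim, CMField.halfDegree]; omega
  exact not_hc_cm_pbMod hX (by norm_num) hdim' hI (hodgeClassesOf_three_ne_bot M hN1 hN2 hN3 hN4 (by omega) Φ)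

end Universe

end HodgeCM

end
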